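import Summits.ResolutionOfSingularities.ResolutionOfSingularities.Theorems.FrobeniusClosingPatchingRelPerfectMonomialGameBridge
import Summits.ResolutionOfSingularities.ResolutionOfSingularities.Theorems.FrobeniusClosingPatchingRelPerfectMonomialPolyhedraGameMarked
import HarnessLib

/-!
# Crux `PatchingRelPerfect` (stmt-ResolutionOfSingularities-16161), chain w52 — TargetsF3 (m)
# «M2-strong», COMBINATORIAL HALF, Route K step K4a: the MARKED SUPPORT of a sum of monomials is read
# off the weights (order of a sum = minimum of the orders)

[OURS · L1 W5.2 · res-L1-w52-plan-1 RULING «Route K approved» 07:37:28Z; design memo v2 §blueprint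
(`wonM_of_next_eq_none`, `permissibleM_of_next_eq_some`); fact-free; nothing here is a statement of the
manuscript under review]

On a scheme with a simple normal crossings boundary, a point `x` lies in the support of the MARKED ideal
`(Σ_{A ∈ 𝒦} Π E^{a}, m)` iff EVERY member has weight `≥ m` at `x` (`weightAt A x = Σ_{j : x ∈ E^j} a_j`):
`mem_support_monomialSum_marked_iff` — the stalk of a sum is the sum of the stalks
(`stalkIdeal_monomialSum_le_iff`, res-L1-w52-stub-4 p509475) and each summand is governed by
`mem_support_monomialMarked_iff` (tree, BGMW §4 Step 2b).  Consequences used by Route K's strategy socket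
(`StrategyAll`, file 2c): empty marked support ⇒ at every point some member has weight `< m`
(`exists_weightAt_lt_of_support_eq_empty`); a point of the marked support on which exactly the divisors of
a stratum pass ⇒ every member has weight `≥ m` there (the permissibility read-out).
-/

-- `Summit.<Summit>.<Sub>.Theorems` with `Sub = Summit` (single-conjunct summit, D-0017)
set_option linter.dupNamespace false

noncomputable section

open CategoryTheory AlgebraicGeometry IsLocalRing Literature.AlgebraicGeometry.Resolution

namespace Summit.ResolutionOfSingularities.ResolutionOfSingularities.Theorems

namespace PolyhedraGame

namespace RouteK

open DepthTargets (monomialSum)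
open MonomialCleanup (stalkIdeal_monomialSum_le_iff)

universe u

variable {X : Scheme.{u}}

/-- [OURS · Route K, K4a] **Marked support of a sum of monomials = points where every member has weight
`≥ m`.** -/
theorem mem_support_monomialSum_marked_iff (𝒦 : List (List (X.IdealSheafData × ℕ)))
    (h𝒦 : ∀ A ∈ 𝒦, HasSNC (boundaryOf A)) (E : List X.IdealSheafData) (m : ℕ) (x : X) :
    x ∈ (⟨monomialSum 𝒦, E, m⟩ : MarkedIdeal X).support ↔ ∀ A ∈ 𝒦, m ≤ weightAt A x := by
  rw [MarkedIdeal.mem_support_iff]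
  change stalkIdeal (monomialSum 𝒦) x ≤ maximalIdeal _ ^ m ↔ _
  rw [stalkIdeal_monomialSum_le_iff]
  refine forall₂_congr fun A hA => ?_
  rw [← mem_support_monomialMarked_iff (h𝒦 A hA) m x, MarkedIdeal.mem_support_iff]
  rfl

/-- [OURS · Route K, K4a] **Empty marked support ⇒ at every point some member has weight `< m`** (the
read-out of Kollár's end condition `cosupp (I_r, m) = ∅` as the game's local win `WonM m`). -/
theorem exists_weightAt_lt_of_support_eq_empty (𝒦 : List (List (X.IdealSheafData × ℕ)))
    (h𝒦 : ∀ A ∈ 𝒦, HasSNC (boundaryOf A)) (E : List X.IdealSheafData) (m : ℕ)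
    (hsupp : (⟨monomialSum 𝒦, E, m⟩ : MarkedIdeal X).support = ∅) (x : X) :
    ∃ A ∈ 𝒦, weightAt A x < m := by
  by_contra h
  push Not at h
  have hx : x ∈ (⟨monomialSum 𝒦, E, m⟩ : MarkedIdeal X).support :=
    (mem_support_monomialSum_marked_iff 𝒦 h𝒦 E m x).mpr h
  rw [hsupp] at hx
  exact hx

/-- [OURS · Route K, K4a] **A subset of the marked support forces weight `≥ m` for every member at each of
its points** (the read-out of Kollár's admissibility `C ⊆ cosupp (I_i, m)` as the game's permissibility
`PermissibleM m`, once the centre's generic point is known to lie on exactly the divisors of a stratum). -/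
theorem forall_le_weightAt_of_subset_support (𝒦 : List (List (X.IdealSheafData × ℕ)))
    (h𝒦 : ∀ A ∈ 𝒦, HasSNC (boundaryOf A)) (E : List X.IdealSheafData) (m : ℕ) {C : Set X}
    (hC : C ⊆ (⟨monomialSum 𝒦, E, m⟩ : MarkedIdeal X).support) {x : X} (hx : x ∈ C) :
    ∀ A ∈ 𝒦, m ≤ weightAt A x :=
  (mem_support_monomialSum_marked_iff 𝒦 h𝒦 E m x).mp (hC hx)

end RouteK

end PolyhedraGame

end Summit.ResolutionOfSingularities.ResolutionOfSingularities.Theorems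

end
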